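import Mathlib
import HarnessLib
import Summits.HubbardSuperconductivity.HubbardSuperconductivity.Theorems.KLProgrammeKLRegimeEnginePairTransferRelResExport

/-!
# Route `KLProgramme` — ENGINE child gen 8 (stmt-HubbardSuperconductivity-20437 `KLRegimeEngineV17F2`), skeleton v2 class #5, Ẽ-organisation (KLTC-INDEX §B′) STEP:
# the INHERITED bar's four-term FT dressing by the rung profiles, SIZED — `klam_inheritedFT_le`
# (cell gate-hubbard-kl, seat hubbard-kl-k3c1-p1 g11, technique «composed-map remainder propagation»; located item #19 «(c)-DRESSING-AVG», (W2-ρ) rows of p1)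

WHY.  In the Ẽ-organisation's STEP (`pairTransferRelResIdx_family_succ`, p594718) the private bar at `n+1` must dominate the FOUR-TERM FT form of the step majorant `S`
(`S(k,k′) + Σ_c S(k,c)ρ₂(c)(3mA/2) + Σ_a (3mA/2)ρ₁(a)S(a,k′) + Σ_aΣ_c (3mA/2)ρ₁(a)S(a,c)ρ₂(c)(3mA/2)`), and `S` contains the INHERITED private bar `RB n = θ·transferBarRelIdx … n j′`
(`…EnginePairTransferRelResExport`: `θ ≤ 1/5`).  With the rung-profile windows ((W2-ρ) p595396: `(A, Z) = (2·369144/π, 738288)`) and the row / column convolution doors of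
`…EngineRelGainWindowed`, the inherited bar's four-term form is SIZED here against the bar's `k′`-free floor `Fₙ = (KlamU)²(2⁻ⁿ + 1/L)·ms + [(Klam|U|)³2⁻ⁿ + thermalBar]·ms`:
under the U-door row `(3/2)·mA·738288 ≤ δ`,
  `θ·Tb(k,k′) + Σ_c θTb(k,c)ρ₂(c)(3mA/2) + Σ_a (3mA/2)ρ₁(a)θTb(a,k′) + Σ_aΣ_c (3mA/2)ρ₁(a)θTb(a,c)ρ₂(c)(3mA/2) ≤ θ·(Tb(k,k′) + (2 + δ)·(6.2·δ)·klIdxPrefactor r n·Fₙ)`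
— so `δ = 1/32` (`mA·738288 ≤ 1/48`) keeps the inherited dressing below `0.4·ρr·Fₙ`, inside the per-step room of `transferBarRelIdx` (mass ×4, thermal ×16 from `n` to `n+1`).
* `klam_conv_arith` (pure arithmetic, generic `(Z, δ, g)`: windowed convolution `≤ (g + 2δ)×` floor per unit `3mA/2`), `klam_poly_le_pow'` (`(n+2)(4n+101) ≤ 210·2ⁿ`),
  **`klam_gain_numeric_rho_le`** (`3mA·Gainₙ^ρ ≤ 4.2δ·2⁻ⁿ` at `I = 2n`), `klam_rowFT_rho_le` / `klam_colFT_rho_le` (one row / column against a rung profile `≤ (6.2δ)·ρr·Fₙ` per unit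
  `3mA/2`), **`klam_inheritedFT_le`**; §4 (appended) **`klam_floor_le_room`** — `ρr·Fₙ ≤` the ROOM term of `transferBarRelIdx_succ_room`, so the inherited dressing is
  `≤ θ·(Tb(k,k′) + (2+δ)(6.2δ)·ROOM)` and rides `pairTransferRelIdx_budget_of_room`.
Arithmetic on landed bars and rows; the SIZES stay hypotheses; nothing asserts any stub, K3 or superconductivity.  0 kit · 0 lit.
-/

noncomputable section

namespace Summit.HubbardSuperconductivity.HubbardSuperconductivity.Theorems.KLRegimeSplit

set_option linter.dupNamespace false -- summit = problem name (single-conjunct summit), D-0017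

open Finset Matrix Literature.MathematicalPhysics.QuantumLattice Literature.Probability.LatticeModels
open Summit.HubbardSuperconductivity.HubbardSuperconductivity.Theorems.KLProgrammeLegKernels
open Summit.HubbardSuperconductivity.HubbardSuperconductivity.Theorems.DispersionFlow
open Summit.HubbardSuperconductivity.HubbardSuperconductivity.Theorems.EngineV8

/-! ## §1 Arithmetic and numerics -/

section Arith

/-- **Generic arithmetic of a windowed convolution against the bar's floor.**  Slots `K2, T ≥ 0`, weights `ms ≥ ov ≥ 0`, `c2 ≥ c4`, `c2, cL ≥ 0`, a weight of total mass
`Z ≥ 0` with `(3/2)·mA·Z ≤ δ`, gain numerics `3mA·Gn ≤ g·c2` (`g, δ ≥ 0`) ⟹ `(3/2)·mA·[ρr·(K2·((2Gn + (c2+cL)Z)·ms + c4·ov·Z) + T·ms·Z)] ≤ (g + 2δ)·ρr·(K2·(c2+cL)·ms + T·ms)`. -/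
theorem klam_conv_arith {ρr K2 T ms ov c2 c4 cL mA Gn Z δ g : ℝ}
    (hρr : 0 ≤ ρr) (hK2 : 0 ≤ K2) (hT : 0 ≤ T) (hms : 0 ≤ ms) (hov : 0 ≤ ov) (hovms : ov ≤ ms) (hc2 : 0 ≤ c2) (hc42 : c4 ≤ c2) (hcL : 0 ≤ cL)
    (hmA : 0 ≤ mA) (hZ0 : 0 ≤ Z) (hδ : 0 ≤ δ) (hg : 0 ≤ g) (hZ : 3 / 2 * mA * Z ≤ δ) (hG : 3 * mA * Gn ≤ g * c2) :
    3 / 2 * mA * (ρr * (K2 * ((2 * Gn + (c2 + cL) * Z) * ms + c4 * ov * Z) + T * ms * Z)) ≤ (g + 2 * δ) * (ρr * (K2 * ((c2 + cL) * ms) + T * ms)) := by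
  have t1 : 3 / 2 * mA * (2 * Gn) ≤ g * (c2 + cL) := by
    have : 3 / 2 * mA * (2 * Gn) = 3 * mA * Gn := by ring
    rw [this]; nlinarith
  have t2 : 3 / 2 * mA * ((c2 + cL) * Z) ≤ δ * (c2 + cL) := by
    have : 3 / 2 * mA * ((c2 + cL) * Z) = (c2 + cL) * (3 / 2 * mA * Z) := by ring
    rw [this]
    have hc : 0 ≤ c2 + cL := by positivity
    nlinarith
  have t3 : 3 / 2 * mA * (c4 * ov * Z) ≤ δ * ((c2 + cL) * ms) := by
    have : 3 / 2 * mA * (c4 * ov * Z) = c4 * ov * (3 / 2 * mA * Z) := by ring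
    rw [this]
    calc c4 * ov * (3 / 2 * mA * Z) ≤ c2 * ms * δ := mul_le_mul (mul_le_mul hc42 hovms hov hc2) hZ (by positivity) (by positivity)
      _ ≤ δ * ((c2 + cL) * ms) := by nlinarith [mul_nonneg hcL hms]
  have t4 : 3 / 2 * mA * (T * ms * Z) ≤ δ * (T * ms) := by
    have : 3 / 2 * mA * (T * ms * Z) = T * ms * (3 / 2 * mA * Z) := by ring
    rw [this]
    have : 0 ≤ T * ms := by positivity
    nlinarith
  have hsplit : 3 / 2 * mA * (ρr * (K2 * ((2 * Gn + (c2 + cL) * Z) * ms + c4 * ov * Z) + T * ms * Z)) =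
      ρr * (K2 * ((3 / 2 * mA * (2 * Gn) + 3 / 2 * mA * ((c2 + cL) * Z)) * ms + 3 / 2 * mA * (c4 * ov * Z)) + 3 / 2 * mA * (T * ms * Z)) := by ring
  rw [hsplit]
  have e1 : (3 / 2 * mA * (2 * Gn) + 3 / 2 * mA * ((c2 + cL) * Z)) * ms ≤ (g * (c2 + cL) + δ * (c2 + cL)) * ms :=
    mul_le_mul_of_nonneg_right (add_le_add t1 t2) hms
  have e2 : K2 * ((3 / 2 * mA * (2 * Gn) + 3 / 2 * mA * ((c2 + cL) * Z)) * ms + 3 / 2 * mA * (c4 * ov * Z)) ≤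
      K2 * ((g * (c2 + cL) + δ * (c2 + cL)) * ms + δ * ((c2 + cL) * ms)) := mul_le_mul_of_nonneg_left (add_le_add e1 t3) hK2
  have e3 : K2 * ((3 / 2 * mA * (2 * Gn) + 3 / 2 * mA * ((c2 + cL) * Z)) * ms + 3 / 2 * mA * (c4 * ov * Z)) + 3 / 2 * mA * (T * ms * Z) ≤
      (g + 2 * δ) * (K2 * ((c2 + cL) * ms) + T * ms) := by
    have hKc : 0 ≤ K2 * ((c2 + cL) * ms) := by positivity
    have hTm : 0 ≤ T * ms := by positivity
    nlinarith [e2, t4]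
  calc ρr * (K2 * ((3 / 2 * mA * (2 * Gn) + 3 / 2 * mA * ((c2 + cL) * Z)) * ms + 3 / 2 * mA * (c4 * ov * Z)) + 3 / 2 * mA * (T * ms * Z))
      ≤ ρr * ((g + 2 * δ) * (K2 * ((c2 + cL) * ms) + T * ms)) := mul_le_mul_of_nonneg_left e3 hρr
    _ = (g + 2 * δ) * (ρr * (K2 * ((c2 + cL) * ms) + T * ms)) := by ring

/-- `(n+2)(4n+101) ≤ 210·2ⁿ`. -/
theorem klam_poly_le_pow' (n : ℕ) : ((n : ℝ) + 2) * (4 * n + 101) ≤ 210 * 2 ^ n := by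
  induction n with
  | zero => norm_num
  | succ k ih =>
      push_cast
      rw [pow_succ]
      nlinarith [ih, sq_nonneg (k : ℝ), (k.cast_nonneg : (0 : ℝ) ≤ k)]

/-- **The rung-profile gain layer cake per unit `3mA` is below `4.2·δ·2⁻ⁿ`** at `I = 2n` under the U-door row `(3/2)·mA·738288 ≤ δ`:
`3mA·(n+2)·((2·369144/π)·Λₙ·(1 + 4n) + 738288/4ⁿ) ≤ (42/10)·δ·2⁻ⁿ`. -/
theorem klam_gain_numeric_rho_le {mA δ : ℝ} (hm : 0 ≤ mA) (hZ : 3 / 2 * mA * 738288 ≤ δ) (n : ℕ) :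
    3 * mA * ((n + 2) * (2 * 369144 / Real.pi * klScale klE0 n * (1 + 2 * ((2 * n : ℕ) : ℝ)) + 738288 / 2 ^ (2 * n))) ≤
      42 / 10 * δ * ((2 : ℝ) ^ n)⁻¹ := by
  have hπ := Real.pi_gt_d2
  have hπ0 := Real.pi_pos
  have hδ : 0 ≤ δ := le_trans (by positivity) hZ
  have hx : (0 : ℝ) < 4 ^ n := by positivity
  have hx2 : (2 : ℝ) ^ (2 * n) = 4 ^ n := by rw [pow_mul]; norm_num
  have hx2' : ((2 : ℝ) ^ n) * 2 ^ n = 4 ^ n := by rw [← hx2, two_mul, pow_add]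
  have hcast : ((2 * n : ℕ) : ℝ) = 2 * n := by push_cast; ring
  have hΛ : klScale klE0 n = 1 / 32 * ((4 : ℝ) ^ n)⁻¹ := by unfold klScale klE0; ring
  have hn0 : (0 : ℝ) ≤ n := n.cast_nonneg
  have h3m : 3 * mA * 738288 ≤ 2 * δ := by linarith
  rw [hcast, hx2, hΛ]
  -- the two summands per unit `3mA`
  have hA : 3 * mA * (2 * 369144 / Real.pi * (1 / 32 * ((4 : ℝ) ^ n)⁻¹) * (1 + 2 * (2 * n))) ≤ 2 * δ * ((1 + 4 * n) / 100) * ((4 : ℝ) ^ n)⁻¹ := by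
    have h14 : (0 : ℝ) ≤ 1 + 4 * n := by positivity
    -- `3mA·738288/(32π) ≤ 2δ/100` from `32π ≥ 100`
    have hkey : 3 * mA * (2 * 369144 / Real.pi * (1 / 32)) ≤ 2 * δ / 100 := by
      have e : 3 * mA * (2 * 369144 / Real.pi * (1 / 32)) = 3 * mA * 738288 / (32 * Real.pi) := by
        field_simp; ring
      rw [e, div_le_div_iff₀ (by positivity) (by norm_num)]
      nlinarith
    calc 3 * mA * (2 * 369144 / Real.pi * (1 / 32 * ((4 : ℝ) ^ n)⁻¹) * (1 + 2 * (2 * n)))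
        = 3 * mA * (2 * 369144 / Real.pi * (1 / 32)) * ((1 + 4 * n) * ((4 : ℝ) ^ n)⁻¹) := by ring
      _ ≤ 2 * δ / 100 * ((1 + 4 * n) * ((4 : ℝ) ^ n)⁻¹) := mul_le_mul_of_nonneg_right hkey (by positivity)
      _ = 2 * δ * ((1 + 4 * n) / 100) * ((4 : ℝ) ^ n)⁻¹ := by ring
  have hB : 3 * mA * (738288 / 4 ^ n) ≤ 2 * δ * ((4 : ℝ) ^ n)⁻¹ := by
    rw [div_eq_mul_inv]
    calc 3 * mA * (738288 * ((4 : ℝ) ^ n)⁻¹) = 3 * mA * 738288 * ((4 : ℝ) ^ n)⁻¹ := by ring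
      _ ≤ 2 * δ * ((4 : ℝ) ^ n)⁻¹ := mul_le_mul_of_nonneg_right h3m (by positivity)
  have hpoly := klam_poly_le_pow' n
  have hn2 : (0 : ℝ) ≤ n + 2 := by positivity
  calc 3 * mA * ((n + 2) * (2 * 369144 / Real.pi * (1 / 32 * ((4 : ℝ) ^ n)⁻¹) * (1 + 2 * (2 * n)) + 738288 / 4 ^ n))
      = (n + 2) * (3 * mA * (2 * 369144 / Real.pi * (1 / 32 * ((4 : ℝ) ^ n)⁻¹) * (1 + 2 * (2 * n))) + 3 * mA * (738288 / 4 ^ n)) := by ring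
    _ ≤ (n + 2) * (2 * δ * ((1 + 4 * n) / 100) * ((4 : ℝ) ^ n)⁻¹ + 2 * δ * ((4 : ℝ) ^ n)⁻¹) := mul_le_mul_of_nonneg_left (add_le_add hA hB) hn2
    _ = 2 * δ * (((n + 2) * (4 * n + 101)) / 100) * ((4 : ℝ) ^ n)⁻¹ := by ring
    _ ≤ 2 * δ * (210 * 2 ^ n / 100) * ((4 : ℝ) ^ n)⁻¹ := by gcongr
    _ = 42 / 10 * δ * ((2 : ℝ) ^ n)⁻¹ := by
        rw [← hx2']
        field_simp
        ring

end Arith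

/-! ## §2 One row / one column of the inherited bar against a rung profile -/

section RowCol

variable {L M : ℕ} [NeZero L] (β μ : ℝ) (K : TrigPolyC4v) {R : RenConsts} {U : ℝ} {N : ℕ}

/-- **ROW**: `(3/2)·mA·Σ_c Tb(k,c)·ρ(c) ≤ (6.2·δ)·ρr·Fₙ` for the rung profile `ρ = klRungProfile … n s_{n+1,j} Qm′` of an admissible frame (`klBetaMin ≤ β ≤ L`, `n+1 ≤ j`,
`π/L ≤ Λₙ`), under `(3/2)·mA·738288 ≤ δ`; `Tb := transferBarRelIdx L G P r β U n m′ Qm`, `Fₙ` its `k′`-free floor. -/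
theorem klam_rowFT_rho_le (hKf : FrameOK R U N μ K) (hβ : klBetaMin ≤ β) (hβL : β ≤ L) {G : GeoConsts} (hCF : 0 ≤ G.CF) {P : SplitConsts} (hKl : 0 ≤ P.Klam)
    {r : ℝ} (hr : 0 ≤ r) (n m' : ℕ) {j : ℕ} (hj : n + 1 ≤ j) (hη₀ : Real.pi / (L : ℝ) ≤ klScale klE0 n) {mA δ : ℝ} (hm : 0 ≤ mA)
    (hZ : 3 / 2 * mA * 738288 ≤ δ) (Qm Qm' k : TorusSite 2 L) :
    3 / 2 * mA * ∑ c, transferBarRelIdx L G P r β U n m' Qm k c * klRungProfile L M β μ K n (softSymbolCompl L M β μ K (n + 1) j) Qm' c ≤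
      (42 / 10 * δ + 2 * δ) * (klIdxPrefactor r n * ((P.Klam * U) ^ 2 * ((((2 : ℝ) ^ n)⁻¹ + ((L : ℝ))⁻¹) * klIdxMass n m') +
        ((P.Klam * |U|) ^ 3 * ((2 : ℝ) ^ n)⁻¹ + thermalBar G P U β n) * klIdxMass n m')) := by
  have hconv := klam_transferBarRelIdx_conv_rungProfile_le (M := M) β μ K hKf hβ hβL hCF hKl hr n m' (2 * n) hj hη₀ Qm Qm' k
  have hG := klam_gain_numeric_rho_le hm hZ n
  have hδ : 0 ≤ δ := le_trans (by positivity) hZ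
  have h2pos : 0 < ((2 : ℝ) ^ n)⁻¹ := by positivity
  have h42 : ((4 : ℝ) ^ n)⁻¹ ≤ ((2 : ℝ) ^ n)⁻¹ :=
    inv_anti₀ (by positivity) (pow_le_pow_left₀ (by norm_num : (0 : ℝ) ≤ 2) (by norm_num : (2 : ℝ) ≤ 4) n)
  have hT : 0 ≤ (P.Klam * |U|) ^ 3 * ((2 : ℝ) ^ n)⁻¹ + thermalBar G P U β n := by
    have := thermalBar_nonneg' hCF P U β n; positivity
  have hmono := mul_le_mul_of_nonneg_left hconv (by positivity : (0 : ℝ) ≤ 3 / 2 * mA)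
  refine hmono.trans ?_
  have := klam_conv_arith (Z := 738288) (klIdxPrefactor_nonneg hr n) (by positivity : (0 : ℝ) ≤ (P.Klam * U) ^ 2) hT (klIdxMass_nonneg n m')
    (klIdxOverlap_nonneg n m') (klIdxOverlap_le_klIdxMass n m') h2pos.le h42 (by positivity : (0 : ℝ) ≤ ((L : ℝ))⁻¹) hm (by norm_num) hδ
    (by positivity : (0 : ℝ) ≤ 42 / 10 * δ) hZ hG
  exact this

/-- **COLUMN**: `(3/2)·mA·Σ_a ρ(a)·Tb(a,y) ≤ (6.2·δ)·ρr·Fₙ` (the bar is symmetric in its momenta). -/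
theorem klam_colFT_rho_le (hKf : FrameOK R U N μ K) (hβ : klBetaMin ≤ β) (hβL : β ≤ L) {G : GeoConsts} (hCF : 0 ≤ G.CF) {P : SplitConsts} (hKl : 0 ≤ P.Klam)
    {r : ℝ} (hr : 0 ≤ r) (n m' : ℕ) {j : ℕ} (hj : n + 1 ≤ j) (hη₀ : Real.pi / (L : ℝ) ≤ klScale klE0 n) {mA δ : ℝ} (hm : 0 ≤ mA)
    (hZ : 3 / 2 * mA * 738288 ≤ δ) (Qm Qm' y : TorusSite 2 L) :
    3 / 2 * mA * ∑ a, klRungProfile L M β μ K n (softSymbolCompl L M β μ K (n + 1) j) Qm' a * transferBarRelIdx L G P r β U n m' Qm a y ≤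
      (42 / 10 * δ + 2 * δ) * (klIdxPrefactor r n * ((P.Klam * U) ^ 2 * ((((2 : ℝ) ^ n)⁻¹ + ((L : ℝ))⁻¹) * klIdxMass n m') +
        ((P.Klam * |U|) ^ 3 * ((2 : ℝ) ^ n)⁻¹ + thermalBar G P U β n) * klIdxMass n m')) := by
  have hsymm : ∑ a, klRungProfile L M β μ K n (softSymbolCompl L M β μ K (n + 1) j) Qm' a * transferBarRelIdx L G P r β U n m' Qm a y =
      ∑ c, transferBarRelIdx L G P r β U n m' Qm y c * klRungProfile L M β μ K n (softSymbolCompl L M β μ K (n + 1) j) Qm' c :=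
    Finset.sum_congr rfl fun a _ => by rw [transferBarRelIdx_swap, mul_comm]
  rw [hsymm]
  exact klam_rowFT_rho_le β μ K hKf hβ hβL hCF hKl hr n m' hj hη₀ hm hZ Qm Qm' y

end RowCol

/-! ## §3 The inherited bar's four-term FT form -/

section FourTerm

variable {L M : ℕ} [NeZero L] (β μ : ℝ) (K : TrigPolyC4v) {R : RenConsts} {U : ℝ} {N : ℕ}

/-- **`klam_inheritedFT_le`** — the four-term FT dressing of the inherited bar `θ·Tb` (`Tb := transferBarRelIdx L G P r β U n m′ Qm`, `0 ≤ θ`) by the rung profiles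
`ρᵢ = klRungProfile … n s_{n+1,jᵢ} Qmᵢ` (`n+1 ≤ jᵢ`) of an admissible frame (`klBetaMin ≤ β ≤ L`, `π/L ≤ Λₙ`), under the U-door row `(3/2)·mA·738288 ≤ δ`:
`θTb(k,k′) + Σ_c θTb(k,c)ρ₂(c)(3mA/2) + Σ_a (3mA/2)ρ₁(a)θTb(a,k′) + Σ_aΣ_c (3mA/2)ρ₁(a)θTb(a,c)ρ₂(c)(3mA/2) ≤ θ·(Tb(k,k′) + (2 + δ)·(6.2δ)·ρr·Fₙ)`,
`ρr·Fₙ = klIdxPrefactor r n·((KlamU)²(2⁻ⁿ + 1/L)·klIdxMass n m′ + [(Klam|U|)³2⁻ⁿ + thermalBar G n]·klIdxMass n m′)`. -/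
theorem klam_inheritedFT_le (hKf : FrameOK R U N μ K) (hβ : klBetaMin ≤ β) (hβL : β ≤ L) {G : GeoConsts} (hCF : 0 ≤ G.CF) {P : SplitConsts} (hKl : 0 ≤ P.Klam)
    {r : ℝ} (hr : 0 ≤ r) (n m' : ℕ) {j₁ j₂ : ℕ} (hj₁ : n + 1 ≤ j₁) (hj₂ : n + 1 ≤ j₂) (hη₀ : Real.pi / (L : ℝ) ≤ klScale klE0 n) {mA δ : ℝ} (hm : 0 ≤ mA)
    (hZ : 3 / 2 * mA * 738288 ≤ δ) {θ : ℝ} (hθ0 : 0 ≤ θ) (Qm Qm₁ Qm₂ k k' : TorusSite 2 L) :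
    θ * transferBarRelIdx L G P r β U n m' Qm k k' +
      ∑ c, θ * transferBarRelIdx L G P r β U n m' Qm k c * klRungProfile L M β μ K n (softSymbolCompl L M β μ K (n + 1) j₂) Qm₂ c * (3 / 2 * mA) +
      ∑ a, 3 / 2 * mA * klRungProfile L M β μ K n (softSymbolCompl L M β μ K (n + 1) j₁) Qm₁ a * (θ * transferBarRelIdx L G P r β U n m' Qm a k') +
      ∑ a, ∑ c, 3 / 2 * mA * klRungProfile L M β μ K n (softSymbolCompl L M β μ K (n + 1) j₁) Qm₁ a * (θ * transferBarRelIdx L G P r β U n m' Qm a c) *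
        klRungProfile L M β μ K n (softSymbolCompl L M β μ K (n + 1) j₂) Qm₂ c * (3 / 2 * mA) ≤
    θ * (transferBarRelIdx L G P r β U n m' Qm k k' + (2 + δ) * (42 / 10 * δ + 2 * δ) *
      (klIdxPrefactor r n * ((P.Klam * U) ^ 2 * ((((2 : ℝ) ^ n)⁻¹ + ((L : ℝ))⁻¹) * klIdxMass n m') +
        ((P.Klam * |U|) ^ 3 * ((2 : ℝ) ^ n)⁻¹ + thermalBar G P U β n) * klIdxMass n m'))) := by
  -- abbreviations by `have`-equalities (no `set`)
  have hδ : 0 ≤ δ := le_trans (by positivity) hZ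
  have hβ0 : 0 < β := pos_of_klBetaMin_le hβ
  have hρ₁0 : ∀ a, 0 ≤ klRungProfile L M β μ K n (softSymbolCompl L M β μ K (n + 1) j₁) Qm₁ a := fun a => klRungProfile_nonneg β μ K hβ0 n _ Qm₁ a
  have hZ₁ : ∑ a, klRungProfile L M β μ K n (softSymbolCompl L M β μ K (n + 1) j₁) Qm₁ a ≤ 738288 := sum_klRungProfile_compl_le β μ K hKf hβ hβL hj₁ Qm₁
  -- row at `k`, column at `k′`, rows at every `a`
  have hrow := klam_rowFT_rho_le (M := M) β μ K hKf hβ hβL hCF hKl hr n m' hj₂ hη₀ hm hZ Qm Qm₂ k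
  have hcol := klam_colFT_rho_le (M := M) β μ K hKf hβ hβL hCF hKl hr n m' hj₁ hη₀ hm hZ Qm Qm₁ k'
  have hrowa : ∀ a, 3 / 2 * mA * ∑ c, transferBarRelIdx L G P r β U n m' Qm a c * klRungProfile L M β μ K n (softSymbolCompl L M β μ K (n + 1) j₂) Qm₂ c ≤
      (42 / 10 * δ + 2 * δ) * (klIdxPrefactor r n * ((P.Klam * U) ^ 2 * ((((2 : ℝ) ^ n)⁻¹ + ((L : ℝ))⁻¹) * klIdxMass n m') +
        ((P.Klam * |U|) ^ 3 * ((2 : ℝ) ^ n)⁻¹ + thermalBar G P U β n) * klIdxMass n m')) := fun a =>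
    klam_rowFT_rho_le (M := M) β μ K hKf hβ hβL hCF hKl hr n m' hj₂ hη₀ hm hZ Qm Qm₂ a
  -- name the floor value
  obtain ⟨F, hF⟩ : ∃ F : ℝ, F = klIdxPrefactor r n * ((P.Klam * U) ^ 2 * ((((2 : ℝ) ^ n)⁻¹ + ((L : ℝ))⁻¹) * klIdxMass n m') +
      ((P.Klam * |U|) ^ 3 * ((2 : ℝ) ^ n)⁻¹ + thermalBar G P U β n) * klIdxMass n m') := ⟨_, rfl⟩
  have hF0 : 0 ≤ F := by
    rw [hF]; have := thermalBar_nonneg' hCF P U β n; have := klIdxPrefactor_nonneg hr n; have := klIdxMass_nonneg n m'; positivity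
  rw [← hF] at hrow hcol hrowa ⊢
  have hC0 : 0 ≤ 42 / 10 * δ + 2 * δ := by positivity
  -- (1) the row term
  have e1 : ∑ c, θ * transferBarRelIdx L G P r β U n m' Qm k c * klRungProfile L M β μ K n (softSymbolCompl L M β μ K (n + 1) j₂) Qm₂ c * (3 / 2 * mA) =
      θ * (3 / 2 * mA * ∑ c, transferBarRelIdx L G P r β U n m' Qm k c * klRungProfile L M β μ K n (softSymbolCompl L M β μ K (n + 1) j₂) Qm₂ c) := by
    rw [Finset.mul_sum, Finset.mul_sum]
    exact Finset.sum_congr rfl fun c _ => by ring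
  -- (2) the column term
  have e2 : ∑ a, 3 / 2 * mA * klRungProfile L M β μ K n (softSymbolCompl L M β μ K (n + 1) j₁) Qm₁ a * (θ * transferBarRelIdx L G P r β U n m' Qm a k') =
      θ * (3 / 2 * mA * ∑ a, klRungProfile L M β μ K n (softSymbolCompl L M β μ K (n + 1) j₁) Qm₁ a * transferBarRelIdx L G P r β U n m' Qm a k') := by
    rw [Finset.mul_sum, Finset.mul_sum]
    exact Finset.sum_congr rfl fun a _ => by ring
  -- (3) the double term: inner rows, then the total mass of `ρ₁`
  have e3 : ∑ a, ∑ c, 3 / 2 * mA * klRungProfile L M β μ K n (softSymbolCompl L M β μ K (n + 1) j₁) Qm₁ a * (θ * transferBarRelIdx L G P r β U n m' Qm a c) *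
        klRungProfile L M β μ K n (softSymbolCompl L M β μ K (n + 1) j₂) Qm₂ c * (3 / 2 * mA) =
      θ * (3 / 2 * mA) * ∑ a, klRungProfile L M β μ K n (softSymbolCompl L M β μ K (n + 1) j₁) Qm₁ a *
        (3 / 2 * mA * ∑ c, transferBarRelIdx L G P r β U n m' Qm a c * klRungProfile L M β μ K n (softSymbolCompl L M β μ K (n + 1) j₂) Qm₂ c) := by
    rw [Finset.mul_sum]
    refine Finset.sum_congr rfl fun a _ => ?_
    rw [Finset.mul_sum, Finset.mul_sum, Finset.mul_sum]
    exact Finset.sum_congr rfl fun c _ => by ring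
  have h3 : ∑ a, klRungProfile L M β μ K n (softSymbolCompl L M β μ K (n + 1) j₁) Qm₁ a *
        (3 / 2 * mA * ∑ c, transferBarRelIdx L G P r β U n m' Qm a c * klRungProfile L M β μ K n (softSymbolCompl L M β μ K (n + 1) j₂) Qm₂ c) ≤
      738288 * ((42 / 10 * δ + 2 * δ) * F) := by
    calc _ ≤ ∑ a, klRungProfile L M β μ K n (softSymbolCompl L M β μ K (n + 1) j₁) Qm₁ a * ((42 / 10 * δ + 2 * δ) * F) :=
          Finset.sum_le_sum fun a _ => mul_le_mul_of_nonneg_left (hrowa a) (hρ₁0 a)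
      _ = (∑ a, klRungProfile L M β μ K n (softSymbolCompl L M β μ K (n + 1) j₁) Qm₁ a) * ((42 / 10 * δ + 2 * δ) * F) := by rw [Finset.sum_mul]
      _ ≤ 738288 * ((42 / 10 * δ + 2 * δ) * F) := mul_le_mul_of_nonneg_right hZ₁ (by positivity)
  rw [e1, e2, e3]
  have hθm : 0 ≤ θ * (3 / 2 * mA) := by positivity
  have i1 := mul_le_mul_of_nonneg_left hrow hθ0
  have i2 := mul_le_mul_of_nonneg_left hcol hθ0
  have i3 := mul_le_mul_of_nonneg_left h3 hθm
  have hd : θ * (3 / 2 * mA) * (738288 * ((42 / 10 * δ + 2 * δ) * F)) = θ * ((3 / 2 * mA * 738288) * ((42 / 10 * δ + 2 * δ) * F)) := by ring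
  rw [hd] at i3
  have i3' : θ * ((3 / 2 * mA * 738288) * ((42 / 10 * δ + 2 * δ) * F)) ≤ θ * (δ * ((42 / 10 * δ + 2 * δ) * F)) :=
    mul_le_mul_of_nonneg_left (mul_le_mul_of_nonneg_right hZ (by positivity)) hθ0
  nlinarith [i1, i2, i3, i3', mul_nonneg hθ0 (mul_nonneg hC0 hF0)]

end FourTerm

/-! ## §4 (appended) The floor is inside the per-step (klIdxPrefactor r (n + 1) * ((P.Klam * U) ^ 2 *
              ((min (klTorusNorm L (k - k') / klScale klE0 (n + 1)) (klScale klE0 (n + 1) / klTorusNorm L (k - k')) +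
                  min (klTorusNorm L (k + k' - Qm) / klScale klE0 (n + 1)) (klScale klE0 (n + 1) / klTorusNorm L (k + k' - Qm)) +
                  ((2 : ℝ) ^ n)⁻¹ + 3 * ((L : ℝ))⁻¹) * klIdxMass n m' + ((4 : ℝ) ^ (n + 1))⁻¹ * klIdxOverlap (n + 1) m') +
            ((P.Klam * |U|) ^ 3 * ((2 : ℝ) ^ n)⁻¹ + 3 * thermalBar G P U β (n + 1)) * klIdxMass n m')) of `transferBarRelIdx_succ_room` -/

section Room

variable {L : ℕ} [NeZero L]

omit [NeZero L] in
/-- **`klam_floor_le_room`** — the bar's `k′`-free floor at scale `n` is below the (klIdxPrefactor r (n + 1) * ((P.Klam * U) ^ 2 *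
              ((min (klTorusNorm L (k - k') / klScale klE0 (n + 1)) (klScale klE0 (n + 1) / klTorusNorm L (k - k')) +
                  min (klTorusNorm L (k + k' - Qm) / klScale klE0 (n + 1)) (klScale klE0 (n + 1) / klTorusNorm L (k + k' - Qm)) +
                  ((2 : ℝ) ^ n)⁻¹ + 3 * ((L : ℝ))⁻¹) * klIdxMass n m' + ((4 : ℝ) ^ (n + 1))⁻¹ * klIdxOverlap (n + 1) m') +
            ((P.Klam * |U|) ^ 3 * ((2 : ℝ) ^ n)⁻¹ + 3 * thermalBar G P U β (n + 1)) * klIdxMass n m')) term of `transferBarRelIdx_succ_room` / `pairTransferRelIdx_budget_of_room`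
(`klIdxPrefactor r n ≤ klIdxPrefactor r (n+1)`, the two `min` gains `≥ 0`, `1/L ≤ 3/L`, `thermalBar n ≤ 3·thermalBar (n+1)`, the overlap slot `≥ 0`). -/
theorem klam_floor_le_room {G : GeoConsts} (hCF : 0 ≤ G.CF) {P : SplitConsts} (hKl : 0 ≤ P.Klam) {r : ℝ} (hr : 0 ≤ r) (β U : ℝ) (n m' : ℕ)
    (Qm k k' : TorusSite 2 L) :
    (klIdxPrefactor r n * ((P.Klam * U) ^ 2 * ((((2 : ℝ) ^ n)⁻¹ + ((L : ℝ))⁻¹) * klIdxMass n m') +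
        ((P.Klam * |U|) ^ 3 * ((2 : ℝ) ^ n)⁻¹ + thermalBar G P U β n) * klIdxMass n m')) ≤
      (klIdxPrefactor r (n + 1) * ((P.Klam * U) ^ 2 *
              ((min (klTorusNorm L (k - k') / klScale klE0 (n + 1)) (klScale klE0 (n + 1) / klTorusNorm L (k - k')) +
                  min (klTorusNorm L (k + k' - Qm) / klScale klE0 (n + 1)) (klScale klE0 (n + 1) / klTorusNorm L (k + k' - Qm)) +
                  ((2 : ℝ) ^ n)⁻¹ + 3 * ((L : ℝ))⁻¹) * klIdxMass n m' + ((4 : ℝ) ^ (n + 1))⁻¹ * klIdxOverlap (n + 1) m') +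
            ((P.Klam * |U|) ^ 3 * ((2 : ℝ) ^ n)⁻¹ + 3 * thermalBar G P U β (n + 1)) * klIdxMass n m')) := by
  have hρ := klIdxPrefactor_le_succ hr n
  have hρ0 := klIdxPrefactor_nonneg hr n
  have hms := klIdxMass_nonneg n m'
  have hK2 : 0 ≤ (P.Klam * U) ^ 2 := by positivity
  have hcub : 0 ≤ (P.Klam * |U|) ^ 3 * ((2 : ℝ) ^ n)⁻¹ := by positivity
  have hth0 := thermalBar_nonneg' hCF P U β n
  have hth := thermalBar_le_succ hCF P U β n
  have hmin₁ : 0 ≤ min (klTorusNorm L (k - k') / klScale klE0 (n + 1)) (klScale klE0 (n + 1) / klTorusNorm L (k - k')) :=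
    le_min (div_nonneg (torusSupNorm_nonneg _) (klth_klScale_pos _).le) (div_nonneg (klth_klScale_pos _).le (torusSupNorm_nonneg _))
  have hmin₂ : 0 ≤ min (klTorusNorm L (k + k' - Qm) / klScale klE0 (n + 1)) (klScale klE0 (n + 1) / klTorusNorm L (k + k' - Qm)) :=
    le_min (div_nonneg (torusSupNorm_nonneg _) (klth_klScale_pos _).le) (div_nonneg (klth_klScale_pos _).le (torusSupNorm_nonneg _))
  have hov : 0 ≤ ((4 : ℝ) ^ (n + 1))⁻¹ * klIdxOverlap (n + 1) m' := mul_nonneg (by positivity) (klIdxOverlap_nonneg _ _)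
  have hL : 0 ≤ ((L : ℝ))⁻¹ := by positivity
  have h2 : 0 ≤ ((2 : ℝ) ^ n)⁻¹ := by positivity
  -- compare the brackets, then the prefactors
  have hbr : (P.Klam * U) ^ 2 * ((((2 : ℝ) ^ n)⁻¹ + ((L : ℝ))⁻¹) * klIdxMass n m') + ((P.Klam * |U|) ^ 3 * ((2 : ℝ) ^ n)⁻¹ + thermalBar G P U β n) * klIdxMass n m' ≤
      (P.Klam * U) ^ 2 *
          ((min (klTorusNorm L (k - k') / klScale klE0 (n + 1)) (klScale klE0 (n + 1) / klTorusNorm L (k - k')) +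
              min (klTorusNorm L (k + k' - Qm) / klScale klE0 (n + 1)) (klScale klE0 (n + 1) / klTorusNorm L (k + k' - Qm)) +
              ((2 : ℝ) ^ n)⁻¹ + 3 * ((L : ℝ))⁻¹) * klIdxMass n m' + ((4 : ℝ) ^ (n + 1))⁻¹ * klIdxOverlap (n + 1) m') +
        ((P.Klam * |U|) ^ 3 * ((2 : ℝ) ^ n)⁻¹ + 3 * thermalBar G P U β (n + 1)) * klIdxMass n m' := by
    have e1 : (((2 : ℝ) ^ n)⁻¹ + ((L : ℝ))⁻¹) * klIdxMass n m' ≤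
        (min (klTorusNorm L (k - k') / klScale klE0 (n + 1)) (klScale klE0 (n + 1) / klTorusNorm L (k - k')) +
            min (klTorusNorm L (k + k' - Qm) / klScale klE0 (n + 1)) (klScale klE0 (n + 1) / klTorusNorm L (k + k' - Qm)) +
            ((2 : ℝ) ^ n)⁻¹ + 3 * ((L : ℝ))⁻¹) * klIdxMass n m' + ((4 : ℝ) ^ (n + 1))⁻¹ * klIdxOverlap (n + 1) m' := by
      nlinarith
    have e2 : ((P.Klam * |U|) ^ 3 * ((2 : ℝ) ^ n)⁻¹ + thermalBar G P U β n) * klIdxMass n m' ≤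
        ((P.Klam * |U|) ^ 3 * ((2 : ℝ) ^ n)⁻¹ + 3 * thermalBar G P U β (n + 1)) * klIdxMass n m' := by
      apply mul_le_mul_of_nonneg_right _ hms
      have := thermalBar_nonneg' hCF P U β (n + 1)
      linarith
    nlinarith [mul_le_mul_of_nonneg_left e1 hK2]
  have hbr0 : 0 ≤ (P.Klam * U) ^ 2 * ((((2 : ℝ) ^ n)⁻¹ + ((L : ℝ))⁻¹) * klIdxMass n m') + ((P.Klam * |U|) ^ 3 * ((2 : ℝ) ^ n)⁻¹ + thermalBar G P U β n) * klIdxMass n m' := by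
    positivity
  calc (klIdxPrefactor r n * ((P.Klam * U) ^ 2 * ((((2 : ℝ) ^ n)⁻¹ + ((L : ℝ))⁻¹) * klIdxMass n m') +
        ((P.Klam * |U|) ^ 3 * ((2 : ℝ) ^ n)⁻¹ + thermalBar G P U β n) * klIdxMass n m')) ≤ klIdxPrefactor r (n + 1) * ((P.Klam * U) ^ 2 * ((((2 : ℝ) ^ n)⁻¹ + ((L : ℝ))⁻¹) * klIdxMass n m') +
        ((P.Klam * |U|) ^ 3 * ((2 : ℝ) ^ n)⁻¹ + thermalBar G P U β n) * klIdxMass n m') := mul_le_mul_of_nonneg_right hρ hbr0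
    _ ≤ (klIdxPrefactor r (n + 1) * ((P.Klam * U) ^ 2 *
              ((min (klTorusNorm L (k - k') / klScale klE0 (n + 1)) (klScale klE0 (n + 1) / klTorusNorm L (k - k')) +
                  min (klTorusNorm L (k + k' - Qm) / klScale klE0 (n + 1)) (klScale klE0 (n + 1) / klTorusNorm L (k + k' - Qm)) +
                  ((2 : ℝ) ^ n)⁻¹ + 3 * ((L : ℝ))⁻¹) * klIdxMass n m' + ((4 : ℝ) ^ (n + 1))⁻¹ * klIdxOverlap (n + 1) m') +
            ((P.Klam * |U|) ^ 3 * ((2 : ℝ) ^ n)⁻¹ + 3 * thermalBar G P U β (n + 1)) * klIdxMass n m')) := mul_le_mul_of_nonneg_left hbr (hρ0.trans hρ)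

end Room

end Summit.HubbardSuperconductivity.HubbardSuperconductivity.Theorems.KLRegimeSplit

end
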